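import Literature.Computability.MetaComplexity.XorPHPLabelling
import Literature.Computability.MetaComplexity.FpLinearSystems
import HarnessLib

/-!
# From a bounded-depth refutation of a PHP-labelled XOR system to a proof of the bijective pigeonhole principle

Third layer of the Ben-Sasson 2002 / Krajíček 2019 §15.4 type reduction. An XOR system
`E : Fin m → LinEqMod 2 n` over `𝔽₂` is rendered as the CNF `sumEncoding 1 E` (one Boolean
variable per unknown, the canonical CNF of each parity constraint). A simple PHP-labelling
`Λ : OntoPHPReduction.PHPLabel` with `N` holes is **sound** for `E` (`PHPLabel.Sound`) if every
equation of `E` holds under the values `val Λ f g` of every local bijection `(f, g)` consistent on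
the variables of that equation — this is the combinatorial interface a routing structure (walks of
pigeons and holes through a Tseitin graph, grid rows and columns, …) has to supply.

* `PHPLabel.Sound` — the interface;
* `eval_clauseOf_of_sound` — under soundness every clause of the XOR-CNF is true under the
  values of every consistent local bijection (semantics of `sumEncoding 1`);
* monotonicity of the line budgets of `XorPHPLabelling.lean` in the row width;
* `OntoPHPReduction.reduction` — **the reduction**: a depth-`d` `textbookFrege`-proof `π` of
  `¬ ⋀ sumEncoding 1 E`, `E` `ℓ`-sparse with a sound well-formed labelling, yields a depth-`(d+20)`
  proof of `ontoPigeonholeForm (N+1) N` of size at most `redSize N ℓ (proofSize π)` (polynomial in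
  `proofSize π` and `N^{O(ℓ)}`): the substituted proof `π σ` cut against `⊢ ⋀_C Cσ, ¬R`
  (`clauseS` for every clause, conjunction introduction).

With the tree's Ajtai theorem for the bijective principle
(`boundedDepthFrege_ontoPigeonhole_lowerBound_holds`) this gives size lower bounds
`2^{N^{ε}}` for every depth (next file).

References: E. Ben-Sasson, *Hard examples for the bounded depth Frege proof system*, Comput.
Complexity 11 (2002) 109–136; J. Krajíček, *Proof complexity*, CUP 2019, §15.4 (Lemma 15.4.3 and
the discussion of Problem 19.4.5, p. 431: AC⁰-Frege lower bounds for Tseitin formulas via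
reductions).
-/

namespace Literature.Computability.MetaComplexity

open Complexity Complexity.PropForm TextbookFrege

open KrajicekRamsey (litOf clauseOf ofCNF_eq_conjList subst_disjList size_subst_le
  altDepthAux_subst_le dd_clauseOf_le msum_map_var dd_ofCNF_le dd_neg_ofCNF_le)

namespace OntoPHPReduction

/-! ### Soundness of a labelling for an XOR system -/

/-- **A labelling is sound for an XOR system** `E` over `𝔽₂`: every equation holds under the
values of every local bijection consistent on its variables (`eqVars 1 (E i)` lists the unknowns
of the `i`-th equation). [cite: KrajicekProofComplexity2019, §15.4 (the substituted axioms follow from ¬ontoPHP_n)] -/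
def PHPLabel.Sound (Λ : PHPLabel) (N : ℕ) {m n : ℕ} (E : Fin m → LinEqMod 2 n) : Prop :=
  ∀ i : Fin m, ∀ f g : ℕ → ℕ, ConsistentL Λ N (eqVars 1 (E i)) f g →
    (E i).Holds fun j => if val Λ f g j then 1 else 0

variable {Λ : PHPLabel} {N : ℕ}

/-- Evaluation of a rendered literal. [folklore] -/
theorem eval_litOf (α : ℕ → Bool) (l : Literal ℕ) : (litOf l).eval α = Literal.eval α l := by
  unfold litOf Literal.eval
  rcases l with ⟨x, b⟩
  cases b <;> cases hx : α x <;> simp [eval, hx]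

/-- Evaluation of a rendered clause. [folklore] -/
theorem eval_clauseOf (α : ℕ → Bool) (c : Clause ℕ) : (clauseOf c).eval α = Clause.eval α c := by
  rw [Bool.eq_iff_iff]
  unfold clauseOf Clause.eval
  rw [eval_disjList, List.any_eq_true]
  simp only [List.mem_map]
  constructor
  · rintro ⟨_, ⟨l, hl, rfl⟩, h⟩; exact ⟨l, hl, by rw [← eval_litOf]; exact h⟩
  · rintro ⟨l, hl, h⟩; exact ⟨_, ⟨l, hl, rfl⟩, by rw [eval_litOf]; exact h⟩

/-- Block values with blocks of length one are the indicator of the single variable. [folklore] -/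
theorem blockVals_one {n : ℕ} (α : ℕ → Bool) :
    blockVals 2 1 n α = fun j : Fin n => if α j then (1 : ZMod 2) else 0 := by
  funext j
  simp only [blockVals, blockVal, encBlock, xorBlock, List.range_one, List.map_cons, List.map_nil,
    Nat.mul_one, Nat.add_zero, List.filter_cons, List.filter_nil]
  cases α j <;> simp

/-- **Under a sound labelling, every clause of the XOR-CNF is true under every consistent local
bijection.** [cite: KrajicekProofComplexity2019, §15.4] -/
theorem eval_clauseOf_of_sound {m n : ℕ} {E : Fin m → LinEqMod 2 n} (hs : PHPLabel.Sound Λ N E)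
    (i : Fin m) {c : Clause ℕ} (hc : c ∈ equationCNF 1 (E i)) (f g : ℕ → ℕ)
    (hcons : ConsistentL Λ N (eqVars 1 (E i)) f g) : (clauseOf c).eval (val Λ f g) = true := by
  have h1 : (equationCNF 1 (E i)).eval (val Λ f g) = true := by
    rw [eval_equationCNF, blockVals_one]
    exact decide_eq_true (hs i f g hcons)
  rw [CNF.eval_eq_true_iff] at h1
  rw [eval_clauseOf]
  exact h1 c hc

/-! ### Monotonicity of the budgets in the row width -/

/-- `tautLines` is monotone in the size budget. [folklore] -/
theorem tautLines_mono {N₁ N₂ S₁ S₂ : ℕ} (hN : N₁ ≤ N₂) (hS : S₁ ≤ S₂) :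
    tautLines N₁ S₁ ≤ tautLines N₂ S₂ := by
  refine (tautLines_mono_left hN).trans ?_
  unfold tautLines
  exact Nat.mul_le_mul_left _ (by nlinarith [Nat.zero_le ((N₂ + 8) ^ 2)])

/-- `caseLines` is monotone. [folklore] -/
theorem caseLines_mono (N : ℕ) {V₁ V₂ T₁ T₂ : ℕ} (hV : V₁ ≤ V₂) (hT : T₁ ≤ T₂) :
    caseLines N V₁ T₁ ≤ caseLines N V₂ T₂ := by
  unfold caseLines
  have h1 := tautLines_mono (N₁ := 2 * V₁ + 1) (N₂ := 2 * V₂ + 1) (S₁ := 40 * (V₁ + 1)) (S₂ := 40 * (V₂ + 1))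
    (by omega) (by omega)
  have h2 : (T₁ + 2 * V₁ + 9) ^ 2 ≤ (T₂ + 2 * V₂ + 9) ^ 2 := Nat.pow_le_pow_left (by omega) 2
  have h3 : 2 * V₁ * (starLines N + 50 * (T₁ + 2 * V₁ + 9) ^ 2 + 10) ≤
      2 * V₂ * (starLines N + 50 * (T₂ + 2 * V₂ + 9) ^ 2 + 10) := Nat.mul_le_mul (by omega) (by omega)
  omega

/-- `caseBudget` is monotone. [folklore] -/
theorem caseBudget_mono (N : ℕ) {V₁ V₂ T₁ T₂ : ℕ} (hV : V₁ ≤ V₂) (hT : T₁ ≤ T₂) :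
    caseBudget N V₁ T₁ ≤ caseBudget N V₂ T₂ := by
  unfold caseBudget
  have h1 := caseLines_mono N hV hT
  have h2 : (T₁ + 2 * V₁ + 9) ^ 2 ≤ (T₂ + 2 * V₂ + 9) ^ 2 := Nat.pow_le_pow_left (by omega) 2
  omega

/-- `caseStep` is monotone. [folklore] -/
theorem caseStep_mono (N : ℕ) {V₁ V₂ P₁ P₂ : ℕ} (hV : V₁ ≤ V₂) (hP : P₁ ≤ P₂) :
    caseStep N V₁ P₁ ≤ caseStep N V₂ P₂ := by
  unfold caseStep
  have h1 := caseBudget_mono N hV (show 2 * V₁ ≤ 2 * V₂ by omega)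
  have h2 : (P₁ + 2 * V₁ + 6 + 1) ^ 2 ≤ (P₂ + 2 * V₂ + 6 + 1) ^ 2 := Nat.pow_le_pow_left (by omega) 2
  have h3 : (2 * V₁ + 1) * (110 * (P₁ + 2 * V₁ + 6 + 1) ^ 2) ≤ (2 * V₂ + 1) * (110 * (P₂ + 2 * V₂ + 6 + 1) ^ 2) :=
    Nat.mul_le_mul (by omega) (by omega)
  omega

/-- `clauseLines` is monotone in the row width. [folklore] -/
theorem clauseLines_mono (N : ℕ) {V₁ V₂ : ℕ} (hV : V₁ ≤ V₂) : clauseLines N V₁ ≤ clauseLines N V₂ := by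
  unfold clauseLines
  have hP : (N + 1) ^ (2 * V₁) ≤ (N + 1) ^ (2 * V₂) := Nat.pow_le_pow_right (by omega) (by omega)
  have h1 := formsCost_mono N (show 2 * V₁ ≤ 2 * V₂ by omega)
  have h2 : ((N + 1) ^ (2 * V₁) + 3 + 1) ^ 2 ≤ ((N + 1) ^ (2 * V₂) + 3 + 1) ^ 2 := Nat.pow_le_pow_left (by omega) 2
  have h3 := caseStep_mono N hV hP
  have h4 : (N + 1) ^ (2 * V₁) * (caseStep N V₁ ((N + 1) ^ (2 * V₁)) + 2) ≤
      (N + 1) ^ (2 * V₂) * (caseStep N V₂ ((N + 1) ^ (2 * V₂)) + 2) := Nat.mul_le_mul hP (by omega)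
  generalize (N + 1) ^ (2 * V₁) = P₁ at *
  generalize (N + 1) ^ (2 * V₂) = P₂ at *
  omega

/-- The size parameter of the reduction for rows of width `≤ ℓ`. [folklore] -/
def clauseB (N ℓ : ℕ) : ℕ :=
  100 * (2 * ℓ + 2) * (N + 1) ^ (2 * ℓ + 2) + 1000 * (N + 1) ^ 4 + 4000 * (3 * ℓ + 2) * (N + 3)

/-- `clauseB` is monotone in the width. [folklore] -/
theorem clauseB_mono (N : ℕ) {ℓ₁ ℓ₂ : ℕ} (h : ℓ₁ ≤ ℓ₂) : clauseB N ℓ₁ ≤ clauseB N ℓ₂ := by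
  unfold clauseB
  have h1 : (N + 1) ^ (2 * ℓ₁ + 2) ≤ (N + 1) ^ (2 * ℓ₂ + 2) := Nat.pow_le_pow_right (by omega) (by omega)
  have h2 : 100 * (2 * ℓ₁ + 2) * (N + 1) ^ (2 * ℓ₁ + 2) ≤ 100 * (2 * ℓ₂ + 2) * (N + 1) ^ (2 * ℓ₂ + 2) :=
    Nat.mul_le_mul (by omega) h1
  have h3 : 4000 * (3 * ℓ₁ + 2) * (N + 3) ≤ 4000 * (3 * ℓ₂ + 2) * (N + 3) := Nat.mul_le_mul (by omega) le_rfl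
  linarith

/-! ### The reduction -/

/-- The size bound of the reduction:
`redSize N ℓ S = (S + 2000) · (clauseLines N ℓ + 52) · (8 S (8N+19) + clauseB N ℓ)`. [folklore] -/
def redSize (N ℓ S : ℕ) : ℕ :=
  (S + 2000) * (clauseLines N ℓ + 52) * (8 * S * (8 * N + 19) + clauseB N ℓ)

/-- **The reduction of Ben-Sasson's type, assembled.** Let `E` be an `ℓ`-sparse XOR system over
`𝔽₂` and `Λ` a well-formed simple PHP-labelling with `N` holes, sound for `E`. Then every
depth-`d` `textbookFrege`-proof `π` of `¬ ⋀ sumEncoding 1 E` yields a depth-`(d + 20)` proof of the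
bijective pigeonhole tautology `ontoPigeonholeForm (N + 1) N` of size at most
`redSize N ℓ (proofSize π)`: apply `σ` to `π` (`substProofBD`), derive every substituted clause
from `¬R` (`clauseS`), introduce the conjunction and cut.
[cite: KrajicekProofComplexity2019, §15.4 (Lemma 15.4.3: σ(π) combined with the Claim-2 proofs)] -/
theorem reduction {m n ℓ d : ℕ} (E : Fin m → LinEqMod 2 n) (hℓ : ∀ i, (E i).supp.card ≤ ℓ)
    (hΛ : Λ.WF N) (hsound : PHPLabel.Sound Λ N E) {π : List (PropForm ℕ)}
    (hπ : textbookFrege.IsDepthProofOf d π (neg (PropForm.ofCNF (sumEncoding 1 E)))) :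
    ∃ π', textbookFrege.IsDepthProofOf (d + 20) π' (ontoPigeonholeForm (N + 1) N) ∧
      proofSize π' ≤ redSize N ℓ (proofSize π) := by
  set S := proofSize π with hS
  set T := sumEncoding 1 E with hTdef
  set σ := sigma Λ N with hσ
  set Ds := T.map fun c => (clauseOf c).subst σ with hDs
  set R := ophp N with hRdef
  set Dd := d + 19 with hDd
  set B := 8 * S * (8 * N + 19) + clauseB N ℓ with hB
  have hR : R.size ≤ 32 * (N + 1) ^ 4 + 1 := size_ophp_le
  have hddR : (neg R).dd ≤ 4 := dd_neg_ophp_le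
  have hN4 : N + 1 ≤ (N + 1) ^ 4 := Nat.le_self_pow (by norm_num) _
  have hBcl : clauseB N ℓ ≤ B := Nat.le_add_left _ _
  have hB4 : 1000 * (N + 1) ^ 4 ≤ B := by
    have : 1000 * (N + 1) ^ 4 ≤ clauseB N ℓ := by unfold clauseB; omega
    exact this.trans hBcl
  -- the substituted proof: `⊢ ¬ ⋀ Ds`
  have h0 := substProofBD σ (Zσ := 8 * N + 19) (Tσ := 4) (fun x => size_sigma_le hΛ x) (by omega)
    (fun x c => altDepthAux_sigma_le x c) hπ
  rw [PropForm.subst, subst_ofCNF_eq_conjList] at h0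
  have hSB : S * (8 * N + 19) ≤ B := by
    have : S * (8 * N + 19) ≤ 8 * S * (8 * N + 19) := by nlinarith
    exact this.trans (Nat.le_add_right _ _)
  have h0' : BD Dd B S (neg (conjList Ds)) := h0.weaken (by omega) hSB
  -- facts about `Ds`
  have hmsT : msum (T.map clauseOf) + 1 ≤ S := by
    have h1 : (neg (PropForm.ofCNF T)).size ≤ S := size_le_proofSize_of_isDepthProofOf hπ
    rw [size, ofCNF_eq_conjList, size_conjList_eq_msum] at h1
    omega
  have hlenDs : Ds.length ≤ S := by
    rw [hDs, List.length_map]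
    have := length_le_msum (T.map clauseOf)
    rw [List.length_map] at this
    omega
  have hmsDs : msum Ds ≤ S * (8 * N + 19) := by
    have e : Ds = (T.map clauseOf).map (PropForm.subst σ) := by rw [hDs, List.map_map]; rfl
    rw [e]
    exact (msum_map_subst_le (fun x => size_sigma_le hΛ x) (by omega) _).trans
      (Nat.mul_le_mul_right _ (by omega))
  have hddDs : ∀ X ∈ Ds, X.dd ≤ 6 := by
    intro X hX
    obtain ⟨c, -, rfl⟩ := List.mem_map.1 hX
    have h1 := altDepthAux_subst_le (σ := σ) (T := 4) (fun v k => altDepthAux_sigma_le v k) (clauseOf c) 3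
    have h2 : altDepthAux 3 (clauseOf c) ≤ 2 := (altDepthAux_le_altDepth' 3 _).trans (altDepth_clauseOf_le c)
    unfold dd; omega
  -- Step 1: every substituted clause from `¬R`
  have step1 : ∀ Dj ∈ Ds, BD Dd B (clauseLines N ℓ) (disjList [Dj, neg R]) := by
    intro Dj hDj
    obtain ⟨c, hc, rfl⟩ := List.mem_map.1 hDj
    rw [hTdef, sumEncoding, List.mem_flatMap] at hc
    obtain ⟨i, -, hc⟩ := hc
    have hV := nodup_eqVars 1 (E i)
    have hVlen : (eqVars 1 (E i)).length ≤ ℓ := by rw [length_eqVars, Nat.mul_one]; exact hℓ i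
    have hC : ∀ l ∈ c, l.1 ∈ eqVars 1 (E i) := fun l hl => fst_mem_of_mem_canonicalCNF hc hl
    have hClen : c.length ≤ (eqVars 1 (E i)).length := (length_of_mem_canonicalCNF hc).le
    have h := clauseS (D := Dd) (B := B) hΛ hV hC hClen (fun f g hfg => eval_clauseOf_of_sound hsound i hc f g hfg)
      (by omega) ((clauseB_mono N hVlen).trans hBcl)
    exact h.mono (clauseLines_mono N hVlen)
  -- Step 2: `⊢ ⋀ Ds, ¬R`
  have step2 : BD Dd B (4 + 50 * (5 + 1) ^ 2 + Ds.length * (clauseLines N ℓ + 51))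
      (disjList (conjList Ds :: [neg R])) := by
    refine conjIntroAllS Ds (fun A hA => step1 A hA) (p := 6) ?_ (by omega) (by simp) ?_
    · intro X hX
      rcases List.mem_append.1 hX with hX | hX
      · exact hddDs X hX
      · simp only [List.mem_singleton] at hX; subst hX; exact hddR.trans (by omega)
    · rw [msum_append, msum_cons, msum_nil]; simp only [size]
      have : clauseB N ℓ ≥ 1000 * (N + 1) ^ 4 := by unfold clauseB; omega
      nlinarith [hmsDs, hR, hN4, this]
  -- Step 3: cut against `¬ ⋀ Ds`
  have hddnC : (neg (conjList Ds)).dd ≤ 9 := dd_neg_conjList_le hddDs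
  have h3a : BD Dd B (S + 3) (disjList [neg (conjList Ds)]) := by
    refine unitS h0' (by omega) ?_
    rw [size, size_conjList_eq_msum]; nlinarith [hmsDs, hB4, hN4]
  have h3b : BD Dd B (S + 3 + 50 * (2 + 1) ^ 2) (disjList (neg (conjList Ds) :: [neg R])) := by
    refine subsetN (N := 2) h3a (by simp) (p := 9) ?_ (by omega) ?_ (by simp) (by simp)
    · intro X hX
      simp only [List.mem_cons, List.not_mem_nil, or_false] at hX
      rcases hX with rfl | rfl
      · exact hddnC
      · exact hddR.trans (by omega)
    · simp only [size_disjList_cons, size_disjList_nil, size, size_conjList_eq_msum]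
      nlinarith [hmsDs, hB4, hN4, hR]
  have h3c := cutS step2 h3b (by
    simp only [size_disjList_cons, size_disjList_nil, size]; nlinarith [hB4, hN4, hR])
  have e1 : disjList [neg R] = disj (neg R) (const false) := rfl
  rw [e1] at h3c
  have h3d := removeBotB h3c (by
      rw [dd_neg, altDepthAux_one_neg]
      have := altDepthAux_le_dd_succ 1 R
      have := dd_ophp_le (N := N)
      rw [← hRdef] at this; omega) (by simp only [size]; nlinarith [hB4, hN4, hR])
  -- extract the proof
  obtain ⟨π', hπ', hsize⟩ := h3d.exists_isDepthProofOf
  rw [hRdef, ← ontoPigeonholeForm_eq] at hπ'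
  refine ⟨π', ⟨hπ'.1, fun ψ hψ => (hπ'.2 ψ hψ).trans (by omega)⟩, hsize.trans ?_⟩
  -- the arithmetic of the overhead
  rw [redSize, hB]
  have hl : 4 + 50 * (5 + 1) ^ 2 + Ds.length * (clauseLines N ℓ + 51) + (S + 3 + 50 * (2 + 1) ^ 2) + 2 + 8 ≤
      (S + 2000) * (clauseLines N ℓ + 52) := by
    have : Ds.length * (clauseLines N ℓ + 51) ≤ S * (clauseLines N ℓ + 51) := Nat.mul_le_mul_right _ hlenDs
    nlinarith
  exact Nat.mul_le_mul_right _ hl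

end OntoPHPReduction

end Literature.Computability.MetaComplexity
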